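import Summits.QuantumFields.GaugeBoot.OneOverNSeriesBound
import HarnessLib

/-!
# Power series in `β` of the `1/N` coefficients, III: the sums (gauge-boot, ADDENDUM 31 part C)

HONEST FRAMING (cell `pub-gaugeboot`, page 1 of every file): the venture produces certified bounds
on lattice expectations at stated coupling, gauge group, dimension and torus size; NOT a mass gap,
NOT a continuum limit, NOT a string tension; NOT Yang–Mills-summit-bearing (barriers
`FixedCouplingUltralocality`, `PerturbativeInvisibility`).  Strong-coupling `SO(N)` lattice gauge theory with free boundary
condition (S. Chatterjee, Comm. Math. Phys. **366** (2019); S. Chatterjee, J. Jafarov, arXiv:1604.04777); nothing about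
four-dimensional continuum Yang–Mills or a mass gap.

## Content

The power series `g_j(β, s) = Σ_i b_{j,i}(s) βⁱ` built from the coefficient family of `OneOverNSeriesCoeff`: absolute
convergence for `|β| ≤ 1/(2R_j)` with `|g_j(β,s)| ≤ 2B_j Φ_{K_j}(s)` from the Catalan bound (`series_summable_of_bound`, a
geometric comparison), the values at `∅` (`series_nil`), and — the heart of Chatterjee–Jafarov's proof of Theorem 7.1 — the
fact that the sums satisfy the lane's symmetrized RECURSION (5.2) (`series_recursion_of_hasSum`: coefficientwise the recursion
of `seriesCoeff_exists`, summed against `βⁱ`; the deformation terms shift the `β`-degree by one, which is the factor `β`).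

Everything is `[folklore]` given parts A–B.
-/

noncomputable section

open Finset Filter Topology
open Literature.MathematicalPhysics.QuantumFieldTheory.Chatterjee2019LargeN
open Literature.MathematicalPhysics.QuantumFieldTheory.Chatterjee2019LargeN.CoeffCatalanBoundProof

namespace Summit.QuantumFields.GaugeBoot

namespace StringDuality

variable {d : ℕ}

/-! ## Convergence -/

/-- Geometric comparison: if `|aᵢ| ≤ C rⁱ` (`C ≥ 0`, `r > 0`) and `|β| ≤ 1/(2r)`, then `Σ aᵢ βⁱ` converges absolutely,
`|Σ_i aᵢ βⁱ| ≤ 2C`, and `Σ_i |aᵢ| |β|ⁱ ≤ 2C`. [folklore] -/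
theorem series_summable_of_bound {a : ℕ → ℝ} {C r β : ℝ} (hC : 0 ≤ C) (hr : 0 < r) (ha : ∀ i, |a i| ≤ C * r ^ i)
    (hβ : |β| ≤ 1 / (2 * r)) :
    Summable (fun i => |a i| * |β| ^ i) ∧ Summable (fun i => a i * β ^ i) ∧
      (∑' i, |a i| * |β| ^ i) ≤ 2 * C ∧ |∑' i, a i * β ^ i| ≤ 2 * C := by
  have hrβ : r * |β| ≤ 1 / 2 := by
    calc r * |β| ≤ r * (1 / (2 * r)) := mul_le_mul_of_nonneg_left hβ hr.le
      _ = 1 / 2 := by field_simp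
  have hterm : ∀ i, |a i| * |β| ^ i ≤ C * (1 / 2 : ℝ) ^ i := by
    intro i
    calc |a i| * |β| ^ i ≤ C * r ^ i * |β| ^ i := mul_le_mul_of_nonneg_right (ha i) (pow_nonneg (abs_nonneg β) _)
      _ = C * (r * |β|) ^ i := by rw [mul_pow]; ring
      _ ≤ C * (1 / 2 : ℝ) ^ i :=
          mul_le_mul_of_nonneg_left (pow_le_pow_left₀ (mul_nonneg hr.le (abs_nonneg β)) hrβ i) hC
  have hgeo : Summable (fun i : ℕ => C * (1 / 2 : ℝ) ^ i) := summable_geometric_two.mul_left C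
  have hgeo_sum : (∑' i : ℕ, C * (1 / 2 : ℝ) ^ i) = 2 * C := by rw [tsum_mul_left, tsum_geometric_two]; ring
  have habs : Summable (fun i => |a i| * |β| ^ i) :=
    Summable.of_nonneg_of_le (fun i => mul_nonneg (abs_nonneg _) (pow_nonneg (abs_nonneg β) _)) hterm hgeo
  have habs' : Summable (fun i => |a i * β ^ i|) := by
    simpa only [abs_mul, abs_pow] using habs
  have hsum : Summable (fun i => a i * β ^ i) := habs'.of_abs
  have hle : (∑' i, |a i| * |β| ^ i) ≤ 2 * C := by
    rw [← hgeo_sum]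
    exact Summable.tsum_le_tsum hterm habs hgeo
  refine ⟨habs, hsum, hle, ?_⟩
  have hn : Summable (fun i => ‖a i * β ^ i‖) := by simpa only [Real.norm_eq_abs] using habs'
  calc |∑' i, a i * β ^ i| ≤ ∑' i, |a i * β ^ i| := by
        have h := norm_tsum_le_tsum_norm hn
        simpa only [Real.norm_eq_abs] using h
    _ = ∑' i, |a i| * |β| ^ i := by simp only [abs_mul, abs_pow]
    _ ≤ 2 * C := hle

/-! ## The value at `∅` -/

/-- The sums at `∅`: `g_{k+2}(β, ∅) = 𝟙[k = 0]` (only the coefficient `b_{2,0}(∅) = 1` is non-zero).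
[cite: ChatterjeeJafarov2016OneOverN, §7 (a_{0,0}(∅) = 1, a_{i,k}(∅) = 0 otherwise; «note that ψ_k(∅) = 0»)] -/
theorem series_nil {b : ℕ → ℕ → LoopSeq d → ℝ} (hnil : ∀ k i, b (k + 2) i [] = if k = 0 ∧ i = 0 then 1 else 0)
    (k : ℕ) (β : ℝ) :
    HasSum (fun i => b (k + 2) i [] * β ^ i) (if k = 0 then 1 else 0) := by
  have h : (if k = 0 then (1 : ℝ) else 0) = b (k + 2) 0 [] * β ^ 0 := by
    rw [hnil, pow_zero, mul_one]
    by_cases hk : k = 0 <;> simp [hk]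
  rw [h]
  refine hasSum_single 0 fun i hi => ?_
  rw [hnil]
  have : ¬ (k = 0 ∧ i = 0) := fun h' => hi h'.2
  simp [this]

/-! ## The recursion (5.2) for the sums -/

/-- **The sums satisfy the symmetrized recursion.**  Fix `β` and `k`.  If `HasSum (Σ_i b_{j,i}(t) βⁱ) (g_j(t))` for every level
`j ≤ k + 2` and every genuine `t`, and `b` satisfies the coefficient recursion of `seriesCoeff_exists`, then for every genuine non-null `s`:
`|s| g_{k+2}(s) − (Σ_{𝕊⁻} g_{k+2} − Σ_{𝕊⁺} g_{k+2} + β Σ_{𝔻⁻} g_{k+2} − β Σ_{𝔻⁺} g_{k+2})`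
`  = |s| g_{k+1}(s) + (Σ_{𝕋⁻} g_{k+1} − Σ_{𝕋⁺} g_{k+1}) + (Σ_{𝕄⁻} g_k − Σ_{𝕄⁺} g_k)` — the recursion carried by
`oneOverN_master`. [cite: ChatterjeeJafarov2016OneOverN, proof of Theorem 7.1 («So ψ_k satisfies equation (limequns)»); Theorem 5.1 (5.2)] -/
theorem series_recursion_of_hasSum {b : ℕ → ℕ → LoopSeq d → ℝ} {β : ℝ} {g : ℕ → LoopSeq d → ℝ} (k : ℕ)
    (hg : ∀ j, j ≤ k + 2 → ∀ t : LoopSeq d, IsLoopSeq t → HasSum (fun i => b j i t * β ^ i) (g j t))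
    (hrec0 : ∀ (k : ℕ) (s : LoopSeq d), s ≠ [] → (∀ l ∈ s, l ≠ []) →
      (s.len : ℝ) * b (k + 2) 0 s -
          ((∑ o : InvIdx s, b (k + 2) 0 (s.negSplitAt o)) - (∑ o : SameIdx s, b (k + 2) 0 (s.posSplitAt o))) =
        (s.len : ℝ) * b (k + 1) 0 s
          + ((∑ o : SameIdx s, b (k + 1) 0 (s.negTwistAt o)) - ∑ o : InvIdx s, b (k + 1) 0 (s.posTwistAt o))
          + ((∑ o : MergeIdx s, b k 0 (s.negMergeAt o)) - ∑ o : MergeIdx s, b k 0 (s.posMergeAt o)))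
    (hrecS : ∀ (k i : ℕ) (s : LoopSeq d), s ≠ [] → (∀ l ∈ s, l ≠ []) →
      (s.len : ℝ) * b (k + 2) (i + 1) s -
          ((∑ o : InvIdx s, b (k + 2) (i + 1) (s.negSplitAt o)) - (∑ o : SameIdx s, b (k + 2) (i + 1) (s.posSplitAt o))
            + (∑ o : DeformIdx s, b (k + 2) i (s.negDeformAt o)) - (∑ o : DeformIdx s, b (k + 2) i (s.posDeformAt o))) =
        (s.len : ℝ) * b (k + 1) (i + 1) s
          + ((∑ o : SameIdx s, b (k + 1) (i + 1) (s.negTwistAt o)) - ∑ o : InvIdx s, b (k + 1) (i + 1) (s.posTwistAt o))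
          + ((∑ o : MergeIdx s, b k (i + 1) (s.negMergeAt o)) - ∑ o : MergeIdx s, b k (i + 1) (s.posMergeAt o)))
    (s : LoopSeq d) (hs : IsLoopSeq s) (hne : s ≠ []) :
    (s.len : ℝ) * g (k + 2) s -
        ((∑ o : InvIdx s, g (k + 2) (s.negSplitAt o)) - (∑ o : SameIdx s, g (k + 2) (s.posSplitAt o))
          + β * (∑ o : DeformIdx s, g (k + 2) (s.negDeformAt o))
          - β * (∑ o : DeformIdx s, g (k + 2) (s.posDeformAt o))) =
      (s.len : ℝ) * g (k + 1) s
        + ((∑ o : SameIdx s, g (k + 1) (s.negTwistAt o)) - ∑ o : InvIdx s, g (k + 1) (s.posTwistAt o))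
        + ((∑ o : MergeIdx s, g k (s.negMergeAt o)) - ∑ o : MergeIdx s, g k (s.posMergeAt o)) := by
  have hgood : ∀ l ∈ s, l ≠ [] := fun l hl => (hs l hl).2
  -- sums of `HasSum`s over the finite operation index types
  have hfin : ∀ {ι : Type} [Fintype ι] (j : ℕ), j ≤ k + 2 → ∀ (r : ι → LoopSeq d), (∀ o, IsLoopSeq (r o)) →
      HasSum (fun i => (∑ o, b j i (r o)) * β ^ i) (∑ o, g j (r o)) := by
    intro ι _ j hj r hr
    have h := hasSum_sum (s := (Finset.univ : Finset ι)) (fun o _ => hg j hj (r o) (hr o))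
    simpa only [Finset.sum_mul] using h
  -- the shifted deformation sums
  have hshift : ∀ (r : DeformIdx s → LoopSeq d), (∀ o, IsLoopSeq (r o)) →
      HasSum (fun i => (if i = 0 then 0 else ∑ o, b (k + 2) (i - 1) (r o)) * β ^ i) (β * ∑ o, g (k + 2) (r o)) := by
    intro r hr
    have h1 := (hfin (k + 2) le_rfl r hr).mul_left β
    rw [← hasSum_nat_add_iff' 1]
    simp only [Finset.range_one, Finset.sum_singleton, ↓reduceIte, zero_mul, sub_zero, Nat.add_sub_cancel,
      Nat.add_one_ne_zero]
    have hf : (fun n : ℕ => (∑ o, b (k + 2) n (r o)) * β ^ (n + 1)) =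
        fun i : ℕ => β * ((∑ o, b (k + 2) i (r o)) * β ^ i) := by
      funext n; ring
    rw [hf]
    exact h1
  -- the nine series
  have hA := (hg (k + 2) le_rfl s hs).mul_left (s.len : ℝ)
  have hS1 := hfin (k + 2) le_rfl (fun o => s.negSplitAt o) (fun o => hs.negSplitAt o)
  have hS2 := hfin (k + 2) le_rfl (fun o => s.posSplitAt o) (fun o => hs.posSplitAt o)
  have hD1 := hshift (fun o => s.negDeformAt o) (fun o => hs.negDeformAt o)
  have hD2 := hshift (fun o => s.posDeformAt o) (fun o => hs.posDeformAt o)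
  have hP := (hg (k + 1) (by omega) s hs).mul_left (s.len : ℝ)
  have hT1 := hfin (k + 1) (by omega) (fun o => s.negTwistAt o) (fun o => hs.negTwistAt o)
  have hT2 := hfin (k + 1) (by omega) (fun o => s.posTwistAt o) (fun o => hs.posTwistAt o)
  have hM1 := hfin k (by omega) (fun o => s.negMergeAt o) (fun o => hs.negMergeAt o)
  have hM2 := hfin k (by omega) (fun o => s.posMergeAt o) (fun o => hs.posMergeAt o)
  have hL := hA.sub (((hS1.sub hS2).add hD1).sub hD2)
  have hR := (hP.add (hT1.sub hT2)).add (hM1.sub hM2)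
  -- coefficientwise, the two series agree
  have heq : (fun i => (s.len : ℝ) * (b (k + 2) i s * β ^ i) -
        (((∑ o : InvIdx s, b (k + 2) i (s.negSplitAt o)) * β ^ i - (∑ o : SameIdx s, b (k + 2) i (s.posSplitAt o)) * β ^ i
          + (if i = 0 then 0 else ∑ o : DeformIdx s, b (k + 2) (i - 1) (s.negDeformAt o)) * β ^ i)
          - (if i = 0 then 0 else ∑ o : DeformIdx s, b (k + 2) (i - 1) (s.posDeformAt o)) * β ^ i)) =
      (fun i => (s.len : ℝ) * (b (k + 1) i s * β ^ i)
        + ((∑ o : SameIdx s, b (k + 1) i (s.negTwistAt o)) * β ^ i - (∑ o : InvIdx s, b (k + 1) i (s.posTwistAt o)) * β ^ i)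
        + ((∑ o : MergeIdx s, b k i (s.negMergeAt o)) * β ^ i - (∑ o : MergeIdx s, b k i (s.posMergeAt o)) * β ^ i)) := by
    funext i
    rcases i with _ | i
    · simp only [↓reduceIte, zero_mul, add_zero, sub_zero]
      linear_combination (β ^ 0) * hrec0 k s hne hgood
    · simp only [Nat.add_one_ne_zero, ↓reduceIte, Nat.add_sub_cancel]
      linear_combination (β ^ (i + 1)) * hrecS k i s hne hgood
  rw [heq] at hL
  exact hL.unique hR

end StringDuality

end Summit.QuantumFields.GaugeBoot

end
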